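import Summits.CriticalPhenomena.PercolationContinuityZ3.Theorems.Transplant.SkelFrmBParamsBridge0
import Summits.CriticalPhenomena.PercolationContinuityZ3.Theorems.Transplant.SkelPhiRootCrossLink
import Summits.CriticalPhenomena.PercolationContinuityZ3.Theorems.Transplant.SkelPhiCorridorKGValues
import HarnessLib

/-!
# N2 (frames-only node `SamePDropOfSkeletonFrm₁`, OPEN), (R) value layer — part RootLanding: **THE LANDING VERTEX `c₁` OF THE ROOT'S K-G CORRIDOR**
# ((R-37)/(R-41): exact placement over the lattice point `(core1Lo 0 + q, core1Lo 1 + ⌊h_L·q/n_L⌋)`), the rows `hc₁`/`hX₁`, and THE CROSS LINK `hx` DISCHARGED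
# (p3-g17, 2026-08-23; lead g12 08:31:58Z: the (R)-side value rows are the p3 lineage's)

For the first/second-axis skeletons `NegB.rootLegAt_frmQ3C_fst` / `…Q3D_snd` (p354138 / p356852): the corridor `kgCorrSched (HK.kgVals_ok₁ N) …` is read through the
run frame `runX φL c₁ n_L h_L 1`, whose origin `c₁` must put the root bridge's core-`1` box (axis-parallel in the root frame, `KS.B0_core1`) inside the corridor's
core `0` — the parallelogram `|α| ≤ q`, `|β′| ≤ (P + W)·U` (`β′ = n_L·Δy − h_L·Δx`, `U = n_L + |h_L|`, `P = ⌊n_Lℓ_L/U⌋ + 1`).  We land EXACTLY (frames have unit steps):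
* §1 **`KS.X1 := core1Lo 0 + q`**, **`KS.Y1 := core1Lo 1 + ⌊h_L·q/n_L⌋`** (the shear-following transverse offset), `KS.D0 := |X1| + |Y1|`; `X1_eq/Y1_eq`;
  **`hX₁_0`**: `Rs + q + R'0 + n_L < X1` (⟸ (R-F2′) `core1Lo_0_ge`); **`exists_landing0`**: for ANY map with unit steps a vertex `c₁ ∈ B(t, D0)` over `(X1, Y1)`;
* §2 **`hx_rows_0`** — the six numeric rows of p3-g16's `runX_mem_kgCorrSched_core_zero_of_rootFrame` (p357925) at `(lo, hi) := (core1Lo, core1Hi)`, under the two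
  floors `ℓB0 + 2R'0 + 1 ≤ W` (the corridor's transverse window absorbs the bridge box's height — a `g`-floor at the tuple of record, next file) and `R'0 ≤ q`;
  the residue of the shear placement is `E := h_L q mod n_L ∈ [0, n_L)`;
* §3 **`hx_0`** — THE CROSS LINK: for every row set `HK : KGRows n_L ℓ_L h_L v_L R'0 ρ q W` and run length `N`, every root-frame point of the bridge's core-`1` box
  maps into `(kgCorrSched …).core 0` of the run frame at `c₁` — the skeleton's binder `hx` with its `w ∈ graphBall` guard unused.
NON-VACUITY: pure arithmetic/geometry; the two floors are max-floors (`W = 9·sL + 19 ≥ 9g + 10` at `WxQ`, `q = 41·n_L ≥ R'0`).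
builds on p205010 (kernel theorem, internal audit signed; external expert review pending) — nothing in this file uses p205010; NOTHING is claimed about the open node
`SamePDropOfSkeletonFrm₁`.
Lane `prim-bschramm`, seat `prim-bschramm-p3` (gen 17; N2 design owner, (R) column owner); helper file (`--supports stmt-CriticalPhenomena-4575 --as helper`).
[cite: KozmaNitzan2024, §4 Lemma 11 (p. 22), p. 28 ((32) at the root)] [cite: MartineauTassion2017, §4.3 Lemma 4.2]
-/

noncomputable section

open scoped Classical

namespace Summit.CriticalPhenomena.PercolationContinuityZ3.Theorems.Transplant

open Literature.Probability.Percolation Literature.Probability.LatticeModels SimpleGraph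
open Literature.Barriers.CriticalPhenomena (graphBall)

namespace PlanarSkeletonFrm

namespace NegB

open SkelConc (Consts)
open Skelφ (rootFrame shearUnit)
open ChainPlanar (BridgePrm BridgeOK)
open Neg

namespace KS

/-! ## §1 The landing point -/

section Landing

variable (κ : Consts) {V : Type} [DecidableEq V] [Countable V] {G : SimpleGraph V} [G.LocallyFinite] (Φ : PlanarSkeletonFrm G) (t : V) (p : unitInterval)
  (D : Skelφ.StepI.DataNS V) (mk g f qq : ℕ)

/-- **The landing x-offset** `X1 := core1Lo 0 + q` (the bridge landing sits at the BACK END of the corridor's core `0`). [this work] -/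
def X1 : ℤ := (B0 κ Φ t p D mk g f).core1Lo 0 + qq

/-- **The landing y-offset** `Y1 := core1Lo 1 + ⌊h_L·q/n_L⌋` (follows the corridor's shear line back from core `0`'s centre). [this work] -/
def Y1 : ℤ := (B0 κ Φ t p D mk g f).core1Lo 1 + hL κ Φ t p D g f * (qq : ℤ) / (nL κ Φ t p D g f : ℤ)

/-- **The landing depth** `D0 := |X1| + |Y1|` (the skeleton's `D₀`: `c₁ ∈ B(t, D0)`). [this work] -/
def D0 : ℕ := (X1 κ Φ t p D mk g f qq).natAbs + (Y1 κ Φ t p D mk g f qq).natAbs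

/-- `X1 = n_L − R'0 + nB0 + q`. [folklore] -/
theorem X1_eq : X1 κ Φ t p D mk g f qq = (nL κ Φ t p D g f : ℤ) - KS0.R'0 κ Φ t p D mk + nB0 κ Φ t p D mk + qq := by
  unfold X1; rw [(B0_core1 κ Φ t p D mk g f).1]

/-- `Y1 = h_L − R'0 + hB0 + ⌊h_L q/n_L⌋`. [folklore] -/
theorem Y1_eq : Y1 κ Φ t p D mk g f qq = hL κ Φ t p D g f - KS0.R'0 κ Φ t p D mk + hB0 κ Φ t p D mk + hL κ Φ t p D g f * (qq : ℤ) / (nL κ Φ t p D g f : ℤ) := by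
  unfold Y1; rw [(B0_core1 κ Φ t p D mk g f).2.1]

/-- **`hX₁`** (the skeleton's (R-F2′) row): `Rs + q + R'0 + n_L < X1`. [folklore] -/
theorem hX₁_0 : ((KS.Rs t D mk : ℕ) : ℤ) + qq + KS0.R'0 κ Φ t p D mk + nL κ Φ t p D g f < X1 κ Φ t p D mk g f qq := by
  have h := core1Lo_0_ge κ Φ t p D mk g f
  unfold X1
  linarith

/-- **THE LANDING VERTEX EXISTS** (any planar map with unit steps): `c₁ ∈ B_G(t, D0)` with `ψ c₁ − ψ t = (X1, Y1)`. [folklore] -/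
theorem exists_landing0 {ψ : V → Site 2} (hstep : Skelφ.Steps G ψ) :
    ∃ c₁, c₁ ∈ graphBall G t (D0 κ Φ t p D mk g f qq) ∧ ψ c₁ 0 - ψ t 0 = X1 κ Φ t p D mk g f qq ∧ ψ c₁ 1 - ψ t 1 = Y1 κ Φ t p D mk g f qq := by
  obtain ⟨c₁, hc, hy⟩ := Skelφ.exists_mem_graphBall_φ_eq hstep t (ψ t + Skelφ.pt (X1 κ Φ t p D mk g f qq) (Y1 κ Φ t p D mk g f qq))
  have e0 : (ψ t + Skelφ.pt (X1 κ Φ t p D mk g f qq) (Y1 κ Φ t p D mk g f qq)) 0 - ψ t 0 = X1 κ Φ t p D mk g f qq := by simp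
  have e1 : (ψ t + Skelφ.pt (X1 κ Φ t p D mk g f qq) (Y1 κ Φ t p D mk g f qq)) 1 - ψ t 1 = Y1 κ Φ t p D mk g f qq := by simp
  rw [e0, e1] at hc
  refine ⟨c₁, hc, ?_, ?_⟩
  · have := congrFun hy 0; simp only [Pi.add_apply, Skelφ.pt_zero] at this; linarith
  · have := congrFun hy 1; simp only [Pi.add_apply, Skelφ.pt_one] at this; linarith

/-! ## §2 The six numeric rows of the cross link -/

/-- `(⌊nℓ/U⌋ + 1 + W)·U ≥ nℓ + 1 + W·U` (`U = shearUnit n h ≥ 1`). [folklore] -/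
theorem budget_mul_shearUnit_ge (n ℓ W : ℕ) (h : ℤ) (hn : 1 ≤ n) :
    (n : ℤ) * ℓ + 1 + (W : ℤ) * (shearUnit n h : ℤ) ≤ ((n * ℓ / shearUnit n h + 1 + W : ℕ) : ℤ) * (shearUnit n h : ℤ) := by
  have hU : 0 < shearUnit n h := by unfold Skelφ.shearUnit; omega
  have key : n * ℓ + 1 + W * shearUnit n h ≤ (n * ℓ / shearUnit n h + 1 + W) * shearUnit n h := by
    have h1 := Nat.div_add_mod (n * ℓ) (shearUnit n h)
    have h2 := Nat.mod_lt (n * ℓ) hU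
    have h3 : (n * ℓ / shearUnit n h + 1 + W) * shearUnit n h = shearUnit n h * (n * ℓ / shearUnit n h) + shearUnit n h + W * shearUnit n h := by ring
    omega
  exact_mod_cast key

/-- **THE SIX ROWS OF THE CROSS LINK** at `(lo, hi) := (core1Lo, core1Hi)` of the root bridge, `X1`, `Y1`: `hx0`, `hx1` (along: exact, `R'0 ≤ q`) and `hs₁…hs₄`
(across: the shear placement leaves `E = h_L q mod n_L ∈ [0, n_L)`; the box height `ℓ_L + 2R'0 + ℓB0` and the corner terms `2|h_L|R'0` are absorbed by `P·U ≥ n_Lℓ_L + 1`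
and `W ≥ ℓB0 + 2R'0 + 1`). [cite: KozmaNitzan2024, §4 Lemma 11 (p. 22)] -/
theorem hx_rows_0 {W : ℕ} (hn : 1 ≤ nL κ Φ t p D g f) (hW : (ℓB0 κ Φ t p D mk : ℤ) + 2 * KS0.R'0 κ Φ t p D mk + 1 ≤ W) (hRq : KS0.R'0 κ Φ t p D mk ≤ qq) :
    X1 κ Φ t p D mk g f qq - qq ≤ (B0 κ Φ t p D mk g f).core1Lo 0 ∧ (B0 κ Φ t p D mk g f).core1Hi 0 ≤ X1 κ Φ t p D mk g f qq + qq ∧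
    -(((nL κ Φ t p D g f * ℓL κ Φ t p D g f / shearUnit (nL κ Φ t p D g f) (hL κ Φ t p D g f) + 1 + W : ℕ) : ℤ) *
          (shearUnit (nL κ Φ t p D g f) (hL κ Φ t p D g f) : ℤ)) ≤
        (nL κ Φ t p D g f : ℤ) * ((B0 κ Φ t p D mk g f).core1Lo 1 - Y1 κ Φ t p D mk g f qq) -
          hL κ Φ t p D g f * ((B0 κ Φ t p D mk g f).core1Lo 0 - X1 κ Φ t p D mk g f qq) ∧
    -(((nL κ Φ t p D g f * ℓL κ Φ t p D g f / shearUnit (nL κ Φ t p D g f) (hL κ Φ t p D g f) + 1 + W : ℕ) : ℤ) *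
          (shearUnit (nL κ Φ t p D g f) (hL κ Φ t p D g f) : ℤ)) ≤
        (nL κ Φ t p D g f : ℤ) * ((B0 κ Φ t p D mk g f).core1Lo 1 - Y1 κ Φ t p D mk g f qq) -
          hL κ Φ t p D g f * ((B0 κ Φ t p D mk g f).core1Hi 0 - X1 κ Φ t p D mk g f qq) ∧
    (nL κ Φ t p D g f : ℤ) * ((B0 κ Φ t p D mk g f).core1Hi 1 - Y1 κ Φ t p D mk g f qq) -
          hL κ Φ t p D g f * ((B0 κ Φ t p D mk g f).core1Lo 0 - X1 κ Φ t p D mk g f qq) ≤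
        ((nL κ Φ t p D g f * ℓL κ Φ t p D g f / shearUnit (nL κ Φ t p D g f) (hL κ Φ t p D g f) + 1 + W : ℕ) : ℤ) *
          (shearUnit (nL κ Φ t p D g f) (hL κ Φ t p D g f) : ℤ) ∧
    (nL κ Φ t p D g f : ℤ) * ((B0 κ Φ t p D mk g f).core1Hi 1 - Y1 κ Φ t p D mk g f qq) -
          hL κ Φ t p D g f * ((B0 κ Φ t p D mk g f).core1Hi 0 - X1 κ Φ t p D mk g f qq) ≤
        ((nL κ Φ t p D g f * ℓL κ Φ t p D g f / shearUnit (nL κ Φ t p D g f) (hL κ Φ t p D g f) + 1 + W : ℕ) : ℤ) *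
          (shearUnit (nL κ Φ t p D g f) (hL κ Φ t p D g f) : ℤ) := by
  obtain ⟨c0, c1, c2, c3⟩ := B0_core1 κ Φ t p D mk g f
  have hn0 : (0 : ℤ) < (nL κ Φ t p D g f : ℤ) := by exact_mod_cast hn
  have hR0 : (0 : ℤ) ≤ (KS0.R'0 κ Φ t p D mk : ℤ) := by positivity
  have hRq' : ((KS0.R'0 κ Φ t p D mk : ℕ) : ℤ) ≤ (qq : ℤ) := by exact_mod_cast hRq
  have hW0 : (0 : ℤ) ≤ (W : ℤ) := by positivity
  have hℓ0 : (0 : ℤ) ≤ (ℓL κ Φ t p D g f : ℤ) := by positivity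
  -- the shear unit and the budget `B := (P + W)·U ≥ n_Lℓ_L + 1 + W·n_L + W·|h_L|`
  have hU : (shearUnit (nL κ Φ t p D g f) (hL κ Φ t p D g f) : ℤ) = (nL κ Φ t p D g f : ℤ) + |hL κ Φ t p D g f| := by
    unfold Skelφ.shearUnit; push_cast [Int.natCast_natAbs]; rfl
  have hB := budget_mul_shearUnit_ge (nL κ Φ t p D g f) (ℓL κ Φ t p D g f) W (hL κ Φ t p D g f) hn
  rw [hU] at hB ⊢
  have hBd : ((nL κ Φ t p D g f : ℤ)) * (ℓL κ Φ t p D g f : ℤ) + 1 + (W : ℤ) * (nL κ Φ t p D g f : ℤ) + (W : ℤ) * |hL κ Φ t p D g f| ≤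
      (((nL κ Φ t p D g f * ℓL κ Φ t p D g f / shearUnit (nL κ Φ t p D g f) (hL κ Φ t p D g f) + 1 + W : ℕ) : ℤ)) *
        ((nL κ Φ t p D g f : ℤ) + |hL κ Φ t p D g f|) := by linarith
  -- the placement residue `E = h q − n ⌊h q / n⌋ ∈ [0, n)`
  have hE0 : 0 ≤ hL κ Φ t p D g f * (qq : ℤ) - (nL κ Φ t p D g f : ℤ) * (hL κ Φ t p D g f * (qq : ℤ) / (nL κ Φ t p D g f : ℤ)) := by
    have := Int.emod_nonneg (hL κ Φ t p D g f * (qq : ℤ)) (ne_of_gt hn0); rw [Int.emod_def] at this; linarith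
  have hEn : hL κ Φ t p D g f * (qq : ℤ) - (nL κ Φ t p D g f : ℤ) * (hL κ Φ t p D g f * (qq : ℤ) / (nL κ Φ t p D g f : ℤ)) < (nL κ Φ t p D g f : ℤ) := by
    have := Int.emod_lt_of_pos (hL κ Φ t p D g f * (qq : ℤ)) hn0; rw [Int.emod_def] at this; linarith
  -- the products
  have hha : |hL κ Φ t p D g f * (KS0.R'0 κ Φ t p D mk : ℤ)| = |hL κ Φ t p D g f| * (KS0.R'0 κ Φ t p D mk : ℤ) := by rw [abs_mul, abs_of_nonneg hR0]
  obtain ⟨hhR1, hhR2⟩ := abs_le.1 (le_of_eq hha)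
  have hWn : ((ℓB0 κ Φ t p D mk : ℤ) + 2 * KS0.R'0 κ Φ t p D mk + 1) * (nL κ Φ t p D g f : ℤ) ≤ (W : ℤ) * (nL κ Φ t p D g f : ℤ) :=
    mul_le_mul_of_nonneg_right hW hn0.le
  have hWh : 2 * (KS0.R'0 κ Φ t p D mk : ℤ) * |hL κ Φ t p D g f| ≤ (W : ℤ) * |hL κ Φ t p D g f| :=
    mul_le_mul_of_nonneg_right (by linarith) (abs_nonneg _)
  have hnℓb : (0 : ℤ) ≤ (nL κ Φ t p D g f : ℤ) * (ℓB0 κ Φ t p D mk : ℤ) := by positivity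
  have hnR : (0 : ℤ) ≤ (nL κ Φ t p D g f : ℤ) * (KS0.R'0 κ Φ t p D mk : ℤ) := by positivity
  have habs : (0 : ℤ) ≤ |hL κ Φ t p D g f| := abs_nonneg _
  have hnℓ : (0 : ℤ) ≤ (nL κ Φ t p D g f : ℤ) * (ℓL κ Φ t p D g f : ℤ) := by positivity
  have hWn0 : (0 : ℤ) ≤ (W : ℤ) * (nL κ Φ t p D g f : ℤ) := by positivity
  have hWh0 : (0 : ℤ) ≤ (W : ℤ) * |hL κ Φ t p D g f| := by positivity
  -- closed forms everywhere
  rw [X1_eq, Y1_eq, c0, c1, c2, c3]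
  refine ⟨by linarith, by linarith, by linarith, by linarith, by linarith, by linarith⟩

/-! ## §3 The cross link -/

/-- **`hx` FOR THE ROOT LEG**: at a landing vertex `c₁` over `(X1, Y1)` (any map `ψ`), every root-frame point of the root bridge's core-`1` box lies in core `0` of the
corridor `kgCorrSched (HK.kgVals_ok₁ N) (HK.kgVals_ok₂ N) (HK.kgVals_split N)` read through `runX ψ c₁ n_L h_L 1` — for EVERY row set `HK` at `R′ := R'0` with
`ℓB0 + 2R'0 + 1 ≤ W` and `R'0 ≤ q`. [cite: KozmaNitzan2024, §4 Lemma 11 (p. 22)] -/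
theorem hx_0 {ρ W : ℕ} (HK : Skelφ.KGRows (nL κ Φ t p D g f) (ℓL κ Φ t p D g f) (hL κ Φ t p D g f) (vL κ Φ t p D g f) (KS0.R'0 κ Φ t p D mk) ρ qq W) (N : ℕ)
    (hW : (ℓB0 κ Φ t p D mk : ℤ) + 2 * KS0.R'0 κ Φ t p D mk + 1 ≤ W) (hRq : KS0.R'0 κ Φ t p D mk ≤ qq)
    {ψ : V → Site 2} {c₁ : V} (hX : ψ c₁ 0 - ψ t 0 = X1 κ Φ t p D mk g f qq) (hY : ψ c₁ 1 - ψ t 1 = Y1 κ Φ t p D mk g f qq)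
    {w : V} (hw : rootFrame ψ t 1 w ∈ Finset.Icc (B0 κ Φ t p D mk g f).core1Lo (B0 κ Φ t p D mk g f).core1Hi) :
    Skelφ.runX ψ c₁ (nL κ Φ t p D g f) (hL κ Φ t p D g f) 1 w ∈ (Skelφ.kgCorrSched (HK.kgVals_ok₁ N) (HK.kgVals_ok₂ N) (HK.kgVals_split N)).core 0 := by
  obtain ⟨hx0, hx1, hs₁, hs₂, hs₃, hs₄⟩ := hx_rows_0 κ Φ t p D mk g f qq HK.hn hW hRq
  exact Skelφ.runX_mem_kgCorrSched_core_zero_of_rootFrame (HK.kgVals_ok₁ N) (HK.kgVals_ok₂ N) (HK.kgVals_split N) HK.hn t c₁ hX hY hx0 hx1 hs₁ hs₂ hs₃ hs₄ hw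

end Landing

end KS

end NegB

end PlanarSkeletonFrm

end Summit.CriticalPhenomena.PercolationContinuityZ3.Theorems.Transplant

end
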